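import Mathlib.Analysis.Complex.Polynomial.Basic
import Mathlib.RingTheory.Polynomial.Eisenstein.Criterion
import Mathlib.RingTheory.Polynomial.Vieta
import Mathlib.RingTheory.Polynomial.GaussLemma
import Mathlib.RingTheory.Int.Basic
import HarnessLib

/-!
# Rational polynomials of every prime degree `p ≥ 5` with Galois group `S_p`

Topic `Literature/NumberTheory/NumberFields`.  Theorem-only file (no definition, no named fact),
classical, Mathlib vocabulary only.

**Theorem** (`exists_irreducible_galActionHom_bijective`).  For every prime `p ≥ 5` there is a
monic irreducible `f ∈ ℚ[X]` of degree `p` whose Galois group acts on the `p` complex roots as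
the FULL symmetric group (`Function.Bijective (Polynomial.Gal.galActionHom f ℂ)`), hence is not
solvable.

The polynomial is the textbook one (Jacobson, *Basic Algebra I*, §4.10, exercise / Stewart,
*Galois Theory*, §15): with `m = p - 2` and an even integer `M` with `2M > Σ_{k<m} (2k+2)²`,

  `f_{m,M}(X) = (X² + M) · ∏_{k<m} (X - (2k+2)) - 2`.

* `f` is Eisenstein at `2` (all non-leading coefficients even, constant term `≡ 2 (mod 4)`),
  hence irreducible (`irreducible_fPoly`);
* `f(2j) = -2 < 0` at the even nodes and `f(2j+1) ≥ 1 > 0` at the odd points `2j+1` with `j`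
  odd (`m` odd), so the intermediate value theorem gives `m = p-2` distinct real roots
  (`le_card_rootSet_real`);
* not all roots are real: if they were, the sum of their squares `e₁² - 2e₂`, read off from the
  two top coefficients which `f` shares with `(X²+M)∏(X-(2k+2))`, would be `Σ(2k+2)² - 2M < 0`
  (`card_rootSet_real_ne`);
* so `f` has between `1` and `3` non-real roots and Mathlib's
  `Polynomial.Gal.galActionHom_bijective_of_prime_degree'` (complex conjugation is a
  transposition; a transitive subgroup of `S_p` containing a transposition is `S_p`) applies.

## References

* N. Jacobson, *Basic Algebra I*, 2nd ed. (1985), §4.10, Thm 4.16 and the example following it.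
* I. Stewart, *Galois Theory*, 4th ed. (2015), Ch. 15 (the general polynomial; `S_p` examples).
* Mathlib, `Archive/Wiedijk100Theorems/AbelRuffini.lean` (T. Browning) — the quintic case,
  whose Eisenstein/IVT pattern is adapted here.
-/

namespace Literature.NumberTheory.NumberFields.SymmetricGaloisRealization

open Polynomial

/-! ### §1. The polynomial family `f_{m,M}` over a commutative ring: algebra -/

section Ring

variable {R : Type*} [CommRing R]

/-- `f_{m,M}` is compatible with ring homomorphisms. [folklore] -/
private theorem map_fPoly {S : Type*} [CommRing S] (φ : R →+* S) (m M : ℕ) :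
    ((X ^ 2 + C (M : R)) * ∏ k ∈ Finset.range m, (X - C ((2 * k + 2 : ℕ) : R)) - C 2).map φ =
      (X ^ 2 + C (M : S)) * ∏ k ∈ Finset.range m, (X - C ((2 * k + 2 : ℕ) : S)) - C 2 := by
  simp only [Polynomial.map_sub, Polynomial.map_mul, Polynomial.map_add, Polynomial.map_pow, map_X,
    Polynomial.map_C, map_natCast φ, Polynomial.map_prod, map_ofNat φ]

/-- The node product `∏_{k<m} (X - (2k+2))` is monic. [folklore] -/
private theorem monic_prodNodes (m : ℕ) :
    (∏ k ∈ Finset.range m, (X - C ((2 * k + 2 : ℕ) : R))).Monic :=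
  monic_prod_of_monic _ _ fun _ _ => monic_X_sub_C _

/-- The node product has degree `m`. [folklore] -/
private theorem natDegree_prodNodes [Nontrivial R] (m : ℕ) :
    (∏ k ∈ Finset.range m, (X - C ((2 * k + 2 : ℕ) : R))).natDegree = m := by
  rw [natDegree_prod_of_monic _ _ fun _ _ => monic_X_sub_C _]
  simp only [natDegree_X_sub_C, Finset.sum_const, Finset.card_range, smul_eq_mul, mul_one]

/-- `(X² + M) ∏ (X - (2k+2))` is monic of degree `m + 2`. [folklore] -/
private theorem monic_gPoly (m M : ℕ) :
    ((X ^ 2 + C (M : R)) * ∏ k ∈ Finset.range m, (X - C ((2 * k + 2 : ℕ) : R))).Monic := by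
  have h1 : (X ^ 2 + C (M : R)).Monic := monic_X_pow_add_C _ (by norm_num)
  exact h1.mul (monic_prodNodes m)

/-- Degree of `(X² + M) ∏ (X - (2k+2))`. [folklore] -/
private theorem natDegree_gPoly [Nontrivial R] (m M : ℕ) :
    ((X ^ 2 + C (M : R)) * ∏ k ∈ Finset.range m, (X - C ((2 * k + 2 : ℕ) : R))).natDegree
      = m + 2 := by
  have h1 : (X ^ 2 + C (M : R)).Monic := monic_X_pow_add_C _ (by norm_num)
  rw [h1.natDegree_mul (monic_prodNodes m), natDegree_prodNodes, natDegree_X_pow_add_C]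
  ring

/-- `f_{m,M}` is monic. [folklore] -/
private theorem monic_fPoly [Nontrivial R] (m M : ℕ) :
    ((X ^ 2 + C (M : R)) * ∏ k ∈ Finset.range m, (X - C ((2 * k + 2 : ℕ) : R)) - C 2).Monic := by
  apply (monic_gPoly m M).sub_of_left
  calc (C (2 : R)).degree ≤ 0 := degree_C_le
    _ < _ := by
      rw [degree_eq_natDegree (monic_gPoly (R := R) m M).ne_zero, natDegree_gPoly]
      exact_mod_cast Nat.succ_pos _

/-- `f_{m,M}` has degree `m + 2`. [folklore] -/
private theorem natDegree_fPoly [Nontrivial R] (m M : ℕ) :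
    ((X ^ 2 + C (M : R)) * ∏ k ∈ Finset.range m, (X - C ((2 * k + 2 : ℕ) : R)) - C 2).natDegree
      = m + 2 := by
  rw [natDegree_sub_C, natDegree_gPoly]

/-- Evaluation of `f_{m,M}`. [folklore] -/
private theorem eval_fPoly (m M : ℕ) (x : R) :
    ((X ^ 2 + C (M : R)) * ∏ k ∈ Finset.range m, (X - C ((2 * k + 2 : ℕ) : R)) - C 2).eval x
      = (x ^ 2 + M) * ∏ k ∈ Finset.range m, (x - ((2 * k + 2 : ℕ) : R)) - 2 := by
  simp [eval_prod]

/-- The coefficient of `X^{m+1}` in `f_{m,M}` is `-Σ_{k<m} (2k+2)` (for `m ≥ 1`). [folklore] -/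
private theorem coeff_fPoly_succ [Nontrivial R] (m M : ℕ) (hm : 1 ≤ m) :
    ((X ^ 2 + C (M : R)) * ∏ k ∈ Finset.range m, (X - C ((2 * k + 2 : ℕ) : R)) - C 2).coeff
        (m + 1) = -∑ k ∈ Finset.range m, ((2 * k + 2 : ℕ) : R) := by
  classical
  set T : Multiset R := (Finset.range m).val.map fun k => ((2 * k + 2 : ℕ) : R) with hT
  have hcard : Multiset.card T = m := by simp [hT]
  have hprod : ∏ k ∈ Finset.range m, (X - C ((2 * k + 2 : ℕ) : R))
      = (T.map fun t => X - C t).prod := by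
    rw [hT, Multiset.map_map, Finset.prod_eq_multiset_prod]
    rfl
  rw [coeff_sub, coeff_C, if_neg (by omega), sub_zero, add_mul, coeff_add, hprod,
    coeff_X_pow_mul', if_pos (by omega), coeff_C_mul]
  have h1 : (T.map fun t => X - C t).prod.coeff (m + 1 - 2) = -T.sum := by
    rw [Multiset.prod_X_sub_C_coeff T (by rw [hcard]; omega), hcard,
      show m - (m + 1 - 2) = 1 by omega]
    simp [Multiset.esymm, Multiset.powersetCard_one]
  have h2 : (T.map fun t => X - C t).prod.coeff (m + 1) = 0 := by
    apply coeff_eq_zero_of_natDegree_lt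
    rw [natDegree_multiset_prod_X_sub_C_eq_card, hcard]
    omega
  rw [h1, h2, mul_zero, add_zero, hT]
  simp [Finset.sum_eq_multiset_sum]

/-- The coefficient of `X^m` in `f_{m,M}` is `e₂(2,4,…,2m) + M` (for `m ≥ 2`). [folklore] -/
private theorem coeff_fPoly_self [Nontrivial R] (m M : ℕ) (hm : 2 ≤ m) :
    ((X ^ 2 + C (M : R)) * ∏ k ∈ Finset.range m, (X - C ((2 * k + 2 : ℕ) : R)) - C 2).coeff m
      = ((Finset.range m).val.map fun k => ((2 * k + 2 : ℕ) : R)).esymm 2 + M := by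
  classical
  set T : Multiset R := (Finset.range m).val.map fun k => ((2 * k + 2 : ℕ) : R) with hT
  have hcard : Multiset.card T = m := by simp [hT]
  have hprod : ∏ k ∈ Finset.range m, (X - C ((2 * k + 2 : ℕ) : R))
      = (T.map fun t => X - C t).prod := by
    rw [hT, Multiset.map_map, Finset.prod_eq_multiset_prod]
    rfl
  rw [coeff_sub, coeff_C, if_neg (by omega), sub_zero, add_mul, coeff_add, hprod,
    coeff_X_pow_mul', if_pos (by omega), coeff_C_mul]
  have h1 : (T.map fun t => X - C t).prod.coeff (m - 2) = T.esymm 2 := by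
    rw [Multiset.prod_X_sub_C_coeff T (by rw [hcard]; omega), hcard,
      show m - (m - 2) = 2 by omega]
    simp
  have h2 : (T.map fun t => X - C t).prod.coeff m = 1 := by
    have hmon : (T.map fun t => X - C t).prod.Monic := by
      rw [← hprod]; exact monic_prodNodes m
    have hdeg : (T.map fun t => X - C t).prod.natDegree = m := by
      rw [natDegree_multiset_prod_X_sub_C_eq_card, hcard]
    rw [← hdeg]
    exact hmon.coeff_natDegree
  rw [h1, h2, mul_one]

/-- **Sum of squares versus elementary symmetric functions**:
`Σ t² = (Σ t)² - 2 e₂(t)` for a multiset `t`. [folklore] -/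
private theorem multiset_sum_map_sq (s : Multiset R) :
    (s.map fun t => t ^ 2).sum = s.sum ^ 2 - 2 * s.esymm 2 := by
  induction s using Multiset.induction_on with
  | empty => simp [Multiset.esymm]
  | cons a s ih =>
    have hcons : (a ::ₘ s).esymm 2 = s.esymm 2 + a * s.sum := by
      simp only [Multiset.esymm]
      rw [show (2 : ℕ) = 1 + 1 from rfl, Multiset.powersetCard_cons, Multiset.map_add,
        Multiset.sum_add, Multiset.powersetCard_one, Multiset.map_map, Multiset.map_map]
      congr 1
      have : ((fun x : Multiset R => x.prod) ∘ Multiset.cons a) ∘ (fun x : R => ({x} : Multiset R))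
          = fun x => a * x := by
        funext x; simp
      rw [this, Multiset.sum_map_mul_left, Multiset.map_id']
    rw [Multiset.map_cons, Multiset.sum_cons, Multiset.sum_cons, hcons, ih]
    ring

end Ring

/-! ### §2. Irreducibility: Eisenstein at `2` -/

/-- Modulo `2`, `f_{m,M}` with `M` even is `X^{m+2}`. [folklore] -/
private theorem map_fPoly_zmod_two (m M : ℕ) (hM : Even M) :
    ((X ^ 2 + C (M : ℤ)) * ∏ k ∈ Finset.range m, (X - C ((2 * k + 2 : ℕ) : ℤ)) - C 2).map
        (Int.castRingHom (ZMod 2)) = X ^ (m + 2) := by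
  rw [map_fPoly]
  have hM0 : ((M : ℕ) : ZMod 2) = 0 := by
    obtain ⟨r, rfl⟩ := hM
    push_cast
    rw [← two_mul]
    rw [show (2 : ZMod 2) = 0 from rfl, zero_mul]
  have hk0 : ∀ k : ℕ, (((2 * k + 2 : ℕ)) : ZMod 2) = 0 := by
    intro k
    push_cast
    rw [show (2 : ZMod 2) = 0 from rfl]
    ring
  have h2 : (C 2 : (ZMod 2)[X]) = 0 := by
    rw [show (2 : ZMod 2) = 0 from rfl, C_0]
  simp only [hM0, hk0, C_0, add_zero, sub_zero, h2, Finset.prod_const, Finset.card_range]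
  ring

/-- All non-leading coefficients of `f_{m,M}` (`M` even) are even. [folklore] -/
private theorem two_dvd_coeff_fPoly (m M : ℕ) (hM : Even M) (n : ℕ) (hn : n ≠ m + 2) :
    (2 : ℤ) ∣ ((X ^ 2 + C (M : ℤ)) * ∏ k ∈ Finset.range m, (X - C ((2 * k + 2 : ℕ) : ℤ))
      - C 2).coeff n := by
  have h := congr_arg (fun q : (ZMod 2)[X] => q.coeff n) (map_fPoly_zmod_two m M hM)
  simp only [coeff_map, Int.coe_castRingHom, coeff_X_pow, if_neg hn] at h
  exact (ZMod.intCast_zmod_eq_zero_iff_dvd _ 2).mp h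

/-- The constant coefficient of `f_{m,M}` (`m ≥ 2`) is `≡ 2 (mod 4)`, in particular not
divisible by `4`. [folklore] -/
private theorem not_four_dvd_coeff_zero_fPoly (m M : ℕ) (hm : 2 ≤ m) :
    ¬ (4 : ℤ) ∣ ((X ^ 2 + C (M : ℤ)) * ∏ k ∈ Finset.range m, (X - C ((2 * k + 2 : ℕ) : ℤ))
      - C 2).coeff 0 := by
  rw [coeff_zero_eq_eval_zero, eval_fPoly]
  have h4 : (4 : ℤ) ∣ ((0 : ℤ) ^ 2 + M) * ∏ k ∈ Finset.range m, ((0 : ℤ) - ((2 * k + 2 : ℕ) : ℤ)) := by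
    apply dvd_mul_of_dvd_right
    have h1 : (1 : ℕ) ∈ Finset.range m := Finset.mem_range.mpr (by omega)
    rw [← Finset.mul_prod_erase _ _ h1]
    apply dvd_mul_of_dvd_left
    norm_num
  intro h
  obtain ⟨a, ha⟩ := h4
  obtain ⟨b, hb⟩ := h
  omega

/-- **Irreducibility.**  For `m ≥ 2` and `M` even, `f_{m,M}` is irreducible over `ℚ`
(Eisenstein at `2` + Gauss's lemma). [cite: Jacobson1985, §4.10] -/
theorem irreducible_fPoly (m M : ℕ) (hm : 2 ≤ m) (hM : Even M) :
    Irreducible ((X ^ 2 + C (M : ℚ)) * ∏ k ∈ Finset.range m, (X - C ((2 * k + 2 : ℕ) : ℚ))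
      - C 2) := by
  have hmonZ := monic_fPoly (R := ℤ) m M
  rw [← map_fPoly (Int.castRingHom ℚ),
    ← IsPrimitive.Int.irreducible_iff_irreducible_map_cast hmonZ.isPrimitive]
  apply irreducible_of_eisenstein_criterion (P := Ideal.span {(2 : ℤ)})
  · rw [Ideal.span_singleton_prime (by norm_num)]
    exact Int.prime_two
  · rw [hmonZ.leadingCoeff, Ideal.mem_span_singleton]
    norm_num
  · intro n hn
    rw [Ideal.mem_span_singleton]
    apply two_dvd_coeff_fPoly m M hM
    rw [degree_eq_natDegree hmonZ.ne_zero, natDegree_fPoly] at hn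
    exact_mod_cast (WithBot.coe_lt_coe.mp hn).ne
  · rw [degree_eq_natDegree hmonZ.ne_zero, natDegree_fPoly]
    exact_mod_cast Nat.succ_pos _
  · rw [Ideal.span_singleton_pow, Ideal.mem_span_singleton, show ((2 : ℤ) ^ 2) = 4 by norm_num]
    exact not_four_dvd_coeff_zero_fPoly m M hm
  · exact hmonZ.isPrimitive

/-! ### §3. Real roots: at least `m` of them -/

/-- Sign of the node product at an odd point: for `j ≤ m` with `m - j` even,
`∏_{k<m} ((2j+1) - (2k+2)) ≥ 1`. [folklore] -/
private theorem one_le_prod_odd_sub_nodes (j m : ℕ) (hjm : j ≤ m) (he : Even (m - j)) :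
    (1 : ℤ) ≤ ∏ k ∈ Finset.range m, (((2 * j + 1 : ℕ) : ℤ) - ((2 * k + 2 : ℕ) : ℤ)) := by
  rw [← Finset.prod_range_mul_prod_Ico _ hjm]
  have hmul : ∀ a b : ℤ, 1 ≤ a → 1 ≤ b → 1 ≤ a * b := fun a b ha hb => by nlinarith
  have hA : (1 : ℤ) ≤ ∏ k ∈ Finset.range j, (((2 * j + 1 : ℕ) : ℤ) - ((2 * k + 2 : ℕ) : ℤ)) := by
    apply Finset.prod_induction _ (fun x : ℤ => 1 ≤ x) hmul le_rfl
    intro k hk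
    rw [Finset.mem_range] at hk
    push_cast
    omega
  have hB : (1 : ℤ) ≤ ∏ k ∈ Finset.Ico j m, (((2 * j + 1 : ℕ) : ℤ) - ((2 * k + 2 : ℕ) : ℤ)) := by
    have hrw : ∏ k ∈ Finset.Ico j m, (((2 * j + 1 : ℕ) : ℤ) - ((2 * k + 2 : ℕ) : ℤ))
        = ∏ k ∈ Finset.Ico j m, -(((2 * k + 2 : ℕ) : ℤ) - ((2 * j + 1 : ℕ) : ℤ)) := by
      refine Finset.prod_congr rfl fun k _ => by ring
    rw [hrw, Finset.prod_neg, Nat.card_Ico, Even.neg_one_pow he, one_mul]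
    apply Finset.prod_induction _ (fun x : ℤ => 1 ≤ x) hmul le_rfl
    intro k hk
    rw [Finset.mem_Ico] at hk
    push_cast
    omega
  nlinarith

/-- `f_{m,M}(2j+1) ≥ 1` for odd `m`, odd `j ≤ m`, `M ≥ 2`. [folklore] -/
private theorem one_le_eval_fPoly_odd (m M j : ℕ) (hm : Odd m) (hj : Odd j) (hjm : j ≤ m) (hM : 2 ≤ M) :
    (1 : ℝ) ≤ ((X ^ 2 + C (M : ℝ)) * ∏ k ∈ Finset.range m, (X - C ((2 * k + 2 : ℕ) : ℝ))
      - C 2).eval (((2 * j + 1 : ℕ) : ℝ)) := by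
  have he : Even (m - j) := by
    rcases hm with ⟨a, rfl⟩
    rcases hj with ⟨b, rfl⟩
    exact ⟨a - b, by omega⟩
  have hP := one_le_prod_odd_sub_nodes j m hjm he
  rw [eval_fPoly]
  have hcast : ∏ k ∈ Finset.range m, ((((2 * j + 1 : ℕ) : ℝ)) - ((2 * k + 2 : ℕ) : ℝ))
      = ((∏ k ∈ Finset.range m, (((2 * j + 1 : ℕ) : ℤ) - ((2 * k + 2 : ℕ) : ℤ)) : ℤ) : ℝ) := by
    push_cast
    rfl
  rw [hcast]
  have hP' : (1 : ℝ) ≤ ((∏ k ∈ Finset.range m, (((2 * j + 1 : ℕ) : ℤ) - ((2 * k + 2 : ℕ) : ℤ)) : ℤ) : ℝ) := by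
    exact_mod_cast hP
  have hM' : (2 : ℝ) ≤ (M : ℝ) := by exact_mod_cast hM
  have hs1 : (1 : ℝ) ≤ (((2 * j + 1 : ℕ) : ℝ)) := by exact_mod_cast (show 1 ≤ 2 * j + 1 by omega)
  have hsq : (1 : ℝ) ≤ (((2 * j + 1 : ℕ) : ℝ)) ^ 2 := by nlinarith
  have h3 : (3 : ℝ) ≤ (((2 * j + 1 : ℕ) : ℝ)) ^ 2 + (M : ℝ) := by linarith
  have h4 : (((2 * j + 1 : ℕ) : ℝ)) ^ 2 + (M : ℝ) ≤ ((((2 * j + 1 : ℕ) : ℝ)) ^ 2 + (M : ℝ)) *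
      ((∏ k ∈ Finset.range m, (((2 * j + 1 : ℕ) : ℤ) - ((2 * k + 2 : ℕ) : ℤ)) : ℤ) : ℝ) :=
    le_mul_of_one_le_right (by linarith) hP'
  linarith

/-- `f_{m,M}(2j) = -2` at the nodes `2j`, `1 ≤ j ≤ m`. [folklore] -/
private theorem eval_fPoly_node {R : Type*} [CommRing R] (m M j : ℕ) (hj : 1 ≤ j) (hjm : j ≤ m) :
    ((X ^ 2 + C (M : R)) * ∏ k ∈ Finset.range m, (X - C ((2 * k + 2 : ℕ) : R)) - C 2).eval
      (((2 * j : ℕ) : R)) = -2 := by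
  rw [eval_fPoly]
  have hmem : j - 1 ∈ Finset.range m := Finset.mem_range.mpr (by omega)
  rw [Finset.prod_eq_zero hmem]
  · ring
  · have : 2 * (j - 1) + 2 = 2 * j := by omega
    rw [this, sub_self]

/-- **At least `m` real roots.**  For odd `m` and `M ≥ 2`, `f_{m,M}` has at least `m` real
roots: one in each interval `(2j, 2j+1)` (`j ≤ m` odd) and `(2j+1, 2j+2)` (`j ≤ m-1` odd), by
the intermediate value theorem. [cite: Jacobson1985, §4.10] -/
theorem le_card_rootSet_real (m M : ℕ) (hm : Odd m) (hM : 2 ≤ M) :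
    m ≤ Fintype.card (((X ^ 2 + C (M : ℚ)) * ∏ k ∈ Finset.range m, (X - C ((2 * k + 2 : ℕ) : ℚ))
      - C 2).rootSet ℝ) := by
  classical
  set f : ℚ[X] := (X ^ 2 + C (M : ℚ)) * ∏ k ∈ Finset.range m, (X - C ((2 * k + 2 : ℕ) : ℚ))
      - C 2 with hf
  set fR : ℝ[X] := (X ^ 2 + C (M : ℝ)) * ∏ k ∈ Finset.range m, (X - C ((2 * k + 2 : ℕ) : ℝ))
      - C 2 with hfR
  have hmap : f.map (algebraMap ℚ ℝ) = fR := map_fPoly _ m M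
  have hf0 : f ≠ 0 := (monic_fPoly (R := ℚ) m M).ne_zero
  have haeval : ∀ x : ℝ, aeval x f = fR.eval x := by
    intro x; rw [aeval_def, ← eval_map, hmap]
  -- the left endpoints `u i` of the `m` sign-change intervals
  let u : ℕ → ℕ := fun i => if Even i then 2 * i + 2 else 2 * i + 1
  have hcont : ∀ a b : ℝ, ContinuousOn (fun x => fR.eval x) (Set.Icc a b) :=
    fun a b => fR.continuous.continuousOn
  -- each interval `(u i, u i + 1)`, `i < m`, contains a root
  have hroot : ∀ i, i < m → ∃ x : ℝ, (u i : ℝ) < x ∧ x < (u i : ℝ) + 1 ∧ fR.eval x = 0 := by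
    intro i hi
    by_cases hi2 : Even i
    · -- `u i = 2(i+1)` with `i+1` odd: `f(u i) = -2 < 0 < f(u i + 1)`
      have hu : u i = 2 * (i + 1) := by simp only [u, if_pos hi2]; ring
      have hodd : Odd (i + 1) := hi2.add_one
      have h1 : fR.eval ((u i : ℕ) : ℝ) = -2 := by
        rw [hu]; exact eval_fPoly_node m M (i + 1) (by omega) (by omega)
      have h2 : (1 : ℝ) ≤ fR.eval (((u i : ℕ) : ℝ) + 1) := by
        have := one_le_eval_fPoly_odd m M (i + 1) hm hodd (by omega) hM
        rw [hu, ← Nat.cast_succ]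
        exact this
      have hlt : fR.eval ((u i : ℕ) : ℝ) < 0 ∧ 0 < fR.eval (((u i : ℕ) : ℝ) + 1) := by
        constructor <;> linarith
      obtain ⟨x, hx, hx0⟩ := intermediate_value_Ioo (by linarith) (hcont _ _)
        (Set.mem_Ioo.mpr hlt)
      exact ⟨x, hx.1, hx.2, hx0⟩
    · -- `u i = 2i+1` with `i` odd: `f(u i) > 0 > -2 = f(u i + 1)`
      have hiodd : Odd i := Nat.not_even_iff_odd.mp hi2
      have hu : u i = 2 * i + 1 := by simp only [u, if_neg hi2]
      have h1 : (1 : ℝ) ≤ fR.eval ((u i : ℕ) : ℝ) := by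
        rw [hu]; exact one_le_eval_fPoly_odd m M i hm hiodd hi.le hM
      have h2 : fR.eval (((u i : ℕ) : ℝ) + 1) = -2 := by
        have := eval_fPoly_node (R := ℝ) m M (i + 1) (by omega) (by omega)
        rw [hu, ← Nat.cast_succ, show Nat.succ (2 * i + 1) = 2 * (i + 1) by omega]
        exact this
      have hlt : fR.eval (((u i : ℕ) : ℝ) + 1) < 0 ∧ 0 < fR.eval ((u i : ℕ) : ℝ) := by
        constructor <;> linarith
      obtain ⟨x, hx, hx0⟩ := intermediate_value_Ioo' (by linarith) (hcont _ _)
        (Set.mem_Ioo.mpr hlt)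
      exact ⟨x, hx.1, hx.2, hx0⟩
  choose! ρ hρ using hroot
  -- `u` is strictly monotone, so the intervals are disjoint and `ρ` is injective on `range m`
  have hu_lt : ∀ i i', i < i' → u i + 1 ≤ u i' := by
    intro i i' h
    simp only [u]
    split_ifs <;> omega
  have hinj : ∀ i < m, ∀ i' < m, ρ i = ρ i' → i = i' := by
    intro i hi i' hi' h
    by_contra hne
    rcases Nat.lt_or_gt_of_ne hne with hlt | hlt
    · have h1 := (hρ i hi).2.1
      have h2 := (hρ i' hi').1
      have h3 : ((u i : ℕ) : ℝ) + 1 ≤ (u i' : ℝ) := by exact_mod_cast hu_lt i i' hlt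
      rw [h] at h1; linarith
    · have h1 := (hρ i' hi').2.1
      have h2 := (hρ i hi).1
      have h3 : ((u i' : ℕ) : ℝ) + 1 ≤ (u i : ℝ) := by exact_mod_cast hu_lt i' i hlt
      rw [h] at h2; linarith
  have hmemroot : ∀ i < m, ρ i ∈ f.rootSet ℝ := by
    intro i hi
    rw [mem_rootSet_of_ne hf0, haeval]
    exact (hρ i hi).2.2
  let g : Fin m → f.rootSet ℝ := fun i => ⟨ρ i, hmemroot i i.2⟩
  have hg : Function.Injective g := by
    intro i i' h
    exact Fin.ext (hinj i i.2 i' i'.2 (by simpa [g] using congr_arg Subtype.val h))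
  simpa using Fintype.card_le_of_injective g hg

/-! ### §4. Not all roots are real -/

/-- **Not all roots real.**  For `m ≥ 2` and `2M > Σ_{k<m} (2k+2)²`, the number of real roots
of `f_{m,M}` is not `m + 2`: otherwise `f` splits over `ℝ`, and by Vieta the sum of the
squares of its roots is `(Σ(2k+2))² - 2(e₂ + M) = Σ(2k+2)² - 2M < 0`. [cite: Jacobson1985, §4.10] -/
theorem card_rootSet_real_ne (m M : ℕ) (hm : 2 ≤ m)
    (hM : (∑ k ∈ Finset.range m, (2 * k + 2) ^ 2) < 2 * M) :
    Fintype.card (((X ^ 2 + C (M : ℚ)) * ∏ k ∈ Finset.range m, (X - C ((2 * k + 2 : ℕ) : ℚ))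
      - C 2).rootSet ℝ) ≠ m + 2 := by
  classical
  set f : ℚ[X] := (X ^ 2 + C (M : ℚ)) * ∏ k ∈ Finset.range m, (X - C ((2 * k + 2 : ℕ) : ℚ))
      - C 2 with hf
  set fR : ℝ[X] := (X ^ 2 + C (M : ℝ)) * ∏ k ∈ Finset.range m, (X - C ((2 * k + 2 : ℕ) : ℝ))
      - C 2 with hfR
  have hmap : f.map (algebraMap ℚ ℝ) = fR := map_fPoly _ m M
  have hmon : fR.Monic := monic_fPoly (R := ℝ) m M
  have hdeg : fR.natDegree = m + 2 := natDegree_fPoly (R := ℝ) m M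
  intro hcard
  -- card of the root set = card of the root multiset = degree
  have hcard' : Fintype.card (f.rootSet ℝ) = fR.roots.toFinset.card := by
    simp only [rootSet_def, aroots_def, hmap, Finset.coe_sort_coe, Fintype.card_coe]
  have hroots : Multiset.card fR.roots = fR.natDegree := by
    apply le_antisymm (card_roots' fR)
    rw [hdeg, ← hcard, hcard']
    exact Multiset.toFinset_card_le _
  -- Vieta for the two top coefficients
  have hc1 := coeff_eq_esymm_roots_of_card hroots (k := m + 1) (by rw [hdeg]; omega)
  have hc2 := coeff_eq_esymm_roots_of_card hroots (k := m) (by rw [hdeg]; omega)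
  rw [hmon.leadingCoeff, hdeg, show m + 2 - (m + 1) = 1 by omega, one_mul, pow_one,
    coeff_fPoly_succ m M (by omega)] at hc1
  rw [hmon.leadingCoeff, hdeg, show m + 2 - m = 2 by omega, one_mul,
    coeff_fPoly_self m M hm] at hc2
  set T : Multiset ℝ := (Finset.range m).val.map fun k => ((2 * k + 2 : ℕ) : ℝ) with hT
  have he1 : fR.roots.esymm 1 = fR.roots.sum := by
    simp [Multiset.esymm, Multiset.powersetCard_one]
  have hsumT : T.sum = ∑ k ∈ Finset.range m, ((2 * k + 2 : ℕ) : ℝ) := by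
    rw [hT, Finset.sum_eq_multiset_sum]
  -- sum of squares of the (real) roots
  have hsqS : (fR.roots.map fun t => t ^ 2).sum = fR.roots.sum ^ 2 - 2 * fR.roots.esymm 2 :=
    multiset_sum_map_sq fR.roots
  have hsqT : (T.map fun t => t ^ 2).sum = T.sum ^ 2 - 2 * T.esymm 2 := multiset_sum_map_sq T
  have hSsum : fR.roots.sum = T.sum := by
    rw [he1] at hc1
    rw [hsumT]
    linear_combination hc1
  have hSe2 : fR.roots.esymm 2 = T.esymm 2 + M := by
    have : ((-1 : ℝ)) ^ 2 = 1 := by norm_num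
    rw [this, one_mul] at hc2
    linear_combination -hc2
  have hnonneg : (0 : ℝ) ≤ (fR.roots.map fun t => t ^ 2).sum :=
    Multiset.sum_nonneg fun x hx => by
      obtain ⟨t, -, rfl⟩ := Multiset.mem_map.mp hx
      exact sq_nonneg t
  have hTsq : (T.map fun t => t ^ 2).sum = ((∑ k ∈ Finset.range m, (2 * k + 2) ^ 2 : ℕ) : ℝ) := by
    rw [hT, Multiset.map_map]
    push_cast
    rw [Finset.sum_eq_multiset_sum]
    rfl
  have hM' : ((∑ k ∈ Finset.range m, (2 * k + 2) ^ 2 : ℕ) : ℝ) < 2 * (M : ℝ) := by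
    exact_mod_cast hM
  rw [hsqS, hSsum, hSe2] at hnonneg
  rw [hsqT] at hTsq
  nlinarith

/-! ### §5. Assembly: Galois group `S_p` -/

/-- **`S_p`-polynomials of every prime degree `p ≥ 5`** (Jacobson, *Basic Algebra I*, §4.10):
there is a monic irreducible `f ∈ ℚ[X]` of degree `p` whose Galois group, acting on the complex
roots, is the full symmetric group — `Function.Bijective (Polynomial.Gal.galActionHom f ℂ)`;
namely `f = (X² + M)∏_{k<p-2}(X - (2k+2)) - 2` with `M = Σ_{k<p-2}(2k+2)² + 2`, which is
Eisenstein at `2` and has exactly `p - 2` real roots. [cite: Jacobson1985, §4.10 Thm 4.16] -/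
theorem exists_irreducible_galActionHom_bijective (p : ℕ) (hp : p.Prime) (h5 : 5 ≤ p) :
    ∃ f : ℚ[X], f.Monic ∧ Irreducible f ∧ f.natDegree = p ∧
      (letI := @Gal.splits_ℚ_ℂ f; Function.Bijective (Gal.galActionHom f ℂ)) := by
  classical
  letI := fun q : ℚ[X] => @Gal.splits_ℚ_ℂ q
  set m := p - 2 with hm
  set M := (∑ k ∈ Finset.range m, (2 * k + 2) ^ 2) + 2 with hMdef
  have hm2 : 2 ≤ m := by omega
  have hmodd : Odd m := by
    rcases hp.eq_two_or_odd' with h | h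
    · omega
    · rcases h with ⟨a, ha⟩
      exact ⟨a - 1, by omega⟩
  have hMeven : Even M := by
    rw [hMdef]
    apply Even.add _ even_two
    apply Finset.even_sum
    intro k _
    exact ⟨2 * (k + 1) ^ 2, by ring⟩
  have hM2 : 2 ≤ M := by omega
  have hMbig : (∑ k ∈ Finset.range m, (2 * k + 2) ^ 2) < 2 * M := by omega
  set f : ℚ[X] := (X ^ 2 + C (M : ℚ)) * ∏ k ∈ Finset.range m, (X - C ((2 * k + 2 : ℕ) : ℚ))
      - C 2 with hf
  have hirr : Irreducible f := irreducible_fPoly m M hm2 hMeven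
  have hdeg : f.natDegree = p := by rw [hf, natDegree_fPoly]; omega
  refine ⟨f, monic_fPoly m M, hirr, hdeg, ?_⟩
  have hC : Fintype.card (f.rootSet ℂ) = p :=
    (card_rootSet_eq_natDegree hirr.separable (IsAlgClosed.splits _)).trans hdeg
  have hRle : Fintype.card (f.rootSet ℝ) ≤ p := by
    have h := card_rootSet_eq_natDegree hirr.separable (IsAlgClosed.splits (k := ℂ) _)
    -- real roots inject into complex roots... use the root-multiset bound instead
    calc Fintype.card (f.rootSet ℝ) = (f.map (algebraMap ℚ ℝ)).roots.toFinset.card := by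
            simp only [rootSet_def, aroots_def, Finset.coe_sort_coe, Fintype.card_coe]
      _ ≤ Multiset.card (f.map (algebraMap ℚ ℝ)).roots := Multiset.toFinset_card_le _
      _ ≤ (f.map (algebraMap ℚ ℝ)).natDegree := card_roots' _
      _ = p := by rw [natDegree_map, hdeg]
  have hRne : Fintype.card (f.rootSet ℝ) ≠ m + 2 := card_rootSet_real_ne m M hm2 hMbig
  have hRge : m ≤ Fintype.card (f.rootSet ℝ) := le_card_rootSet_real m M hmodd hM2
  apply Gal.galActionHom_bijective_of_prime_degree' hirr
  · rwa [hdeg]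
  · rw [hC]; omega
  · rw [hC]; omega

end Literature.NumberTheory.NumberFields.SymmetricGaloisRealization
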